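import Literature.NumberTheory.NumberFields.DedekindDifferentTheorem
import Literature.NumberTheory.NumberFields.DifferentIdealIntBase
import Literature.NumberTheory.ComplexMultiplication.CMOrderPrimeIdealTwoElement
import Mathlib.NumberTheory.NumberField.Discriminant.Different
import HarnessLib

/-!
# Route CubicResolventAllowance — support `ResolventDiscBounds` (stmt-ABC-22743), part I:
# valuation caps on the discriminant of a number field of degree `≤ 3`

Pure algebraic number theory, no elliptic curve: for a number field `K` of degree `n = [K:ℚ]` and a
prime `p`, with `d_K = NumberField.discr K`,

* `padicValNat_discr_le_of_finrank_lt`: `n < p ⇒ v_p(d_K) ≤ n - 1` (tame: `e ≤ n < p`);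
* `padicValNat_two_discr_le_three`: `n ≤ 3 ⇒ v₂(d_K) ≤ 3`;
* `padicValNat_three_discr_le_five`: `n ≤ 3 ⇒ v₃(d_K) ≤ 5`.

Proof: `|d_K| = N(𝔇_{K/ℚ})` (Mathlib `NumberField.absNorm_differentIdeal`), so
`v_p(d_K) = Σ_{P | p} f_P · s_P` with `s_P = ord_P 𝔇` (the tree's
`NumberRing.padicValNat_absNorm_eq_sum`), and Dedekind's different theorem (the tree's
`DedekindDifferentTheorem`: `s_P = e_P - 1` if `p ∤ e_P`, `s_P + 1 ≤ e_P (v_p(e_P) + 1)` always) with the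
fundamental identity `Σ_{P | p} e_P f_P = n` (Mathlib `Ideal.sum_ramification_inertia`).

These caps feed `|d_K| ≤ 2³·3⁵·N²` / `|d_{K₂}| ≤ 8·N` for the 2-division resolvent fields of an elliptic
curve over `ℚ` (item `ResolventDiscBounds` of route CubicResolventAllowance; the support of `d_K` is
controlled in part II). No conjecture is involved; A-PS is NOT abc.

References: J. Neukirch, *Algebraic Number Theory* (1999), Ch. III (2.6) and Ch. I (8.2);
J.-P. Serre, *Local Fields*, Ch. III §6.
-/

-- `Summit.<Summit>.<Problem>` is the mandated summit-side namespace (CONVENTIONS §2); for the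
-- single-conjunct summit `ABC` the two coincide, so the duplicate `ABC.ABC` is deliberate.
set_option linter.dupNamespace false

noncomputable section

namespace Summit.ABC.ABC.Theorems

open NumberField IsDedekindDomain Ideal UniqueFactorizationMonoid
open Literature.NumberTheory.NumberFields

variable (K : Type*) [Field K] [NumberField K]

/-! ### §1. Per-prime facts over the base `ℤ` -/

/-- A prime of `𝓞 ℚ` is unramified over `ℤ`: `e(𝔭 | ℤ) = 1` (`[ℚ : ℚ] = 1`).
[cite: NeukirchANT1999, Ch. I (8.2)] -/
theorem ramificationIdx_ringOfIntegers_rat_int (𝔭 : Ideal (𝓞 ℚ)) [𝔭.IsMaximal] :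
    𝔭.ramificationIdx ℤ = 1 := by
  have hpos := Ideal.ramificationIdx_pos 𝔭 ℤ
  haveI : 𝔭.LiesOver (𝔭.under ℤ) := ⟨rfl⟩
  haveI : (𝔭.under ℤ).IsMaximal := Ideal.IsMaximal.under ℤ 𝔭
  have hle : (𝔭.under ℤ).ramificationIdx' 𝔭 ≤ Module.finrank ℚ ℚ :=
    Ideal.ramificationIdx_le_finrank (R := ℤ) (S := 𝓞 ℚ) ℚ ℚ 𝔭
  rw [Module.finrank_self, Ideal.ramificationIdx'_eq_ramificationIdx (𝔭.under ℤ) 𝔭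
    (by
      haveI : NeZero 𝔭 := ⟨Ideal.IsMaximal.ne_bot_of_isIntegral_int 𝔭⟩
      rw [(Int.liesOver_span_absNorm 𝔭).over.symm, Ne, Ideal.span_singleton_eq_bot, Nat.cast_eq_zero]
      exact (Nat.absNorm_under_prime 𝔭).ne_zero)] at hle
  omega

/-- The relative ramification index over `𝓞 ℚ` is the absolute one over `ℤ`:
`e(P | P ∩ 𝓞 ℚ) = e(P | p)`. [cite: NeukirchANT1999, Ch. I (8.2)] -/
theorem ramificationIdx_ringOfIntegers_rat_eq (P : Ideal (𝓞 K)) [P.IsMaximal] :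
    P.ramificationIdx (𝓞 ℚ) = P.ramificationIdx ℤ := by
  haveI : (P.under (𝓞 ℚ)).IsMaximal := Ideal.IsMaximal.under (𝓞 ℚ) P
  rw [Ideal.ramificationIdx_tower (R := ℤ) (P.under (𝓞 ℚ)) P,
    ramificationIdx_ringOfIntegers_rat_int, one_mul]

/-- **Tame case of Dedekind's different theorem over `ℤ`**: if `p ∤ e(P|p)` then
`ord_P 𝔇_{K/ℚ} = e(P|p) - 1`. [cite: NeukirchANT1999, Ch. III (2.6)] -/
theorem multiplicity_differentIdeal_int_eq_of_not_dvd (P : Ideal (𝓞 K)) [P.IsMaximal]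
    (h : ¬ Ideal.absNorm (P.under ℤ) ∣ P.ramificationIdx ℤ) :
    multiplicity P (differentIdeal ℤ (𝓞 K)) = P.ramificationIdx ℤ - 1 := by
  rw [differentIdeal_int_eq_differentIdeal_ringOfIntegers_rat K, ← ramificationIdx_ringOfIntegers_rat_eq K P]
  exact multiplicity_differentIdeal_eq_of_not_dvd ℚ K P (by rwa [ramificationIdx_ringOfIntegers_rat_eq K P])

/-- **Dedekind–Hensel bound over `ℤ`**: `ord_P 𝔇_{K/ℚ} + 1 ≤ e(P|p) · (v_p(e(P|p)) + 1)`.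
[cite: NeukirchANT1999, Ch. III (2.6)] -/
theorem multiplicity_differentIdeal_int_succ_le (P : Ideal (𝓞 K)) [P.IsMaximal] :
    multiplicity P (differentIdeal ℤ (𝓞 K)) + 1 ≤
      P.ramificationIdx ℤ * ((P.ramificationIdx ℤ).factorization (Ideal.absNorm (P.under ℤ)) + 1) := by
  have h := multiplicity_differentIdeal_lt_absolute ℚ K P
  rwa [← differentIdeal_int_eq_differentIdeal_ringOfIntegers_rat K,
    ramificationIdx_ringOfIntegers_rat_eq K P] at h

/-- `ord_P 𝔇_{K/ℚ} + 1 ≤ e(P|p)` when `p ∤ e(P|p)`, and `≤ e(P|p)·(v_p(e)+1)` in general — the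
exponent never exceeds `e·(v_p(e) + 1) - 1`; unramified primes (`e = 1`) do not divide `𝔇`.
[cite: NeukirchANT1999, Ch. III (2.6)] -/
theorem multiplicity_differentIdeal_int_eq_zero_of_ramificationIdx_eq_one (P : Ideal (𝓞 K))
    [P.IsMaximal] (h : P.ramificationIdx ℤ = 1) : multiplicity P (differentIdeal ℤ (𝓞 K)) = 0 := by
  rw [multiplicity_differentIdeal_int_eq_of_not_dvd K P ?_, h]
  rw [h, Nat.dvd_one]
  haveI : NeZero P := ⟨Ideal.IsMaximal.ne_bot_of_isIntegral_int P⟩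
  exact (Nat.absNorm_under_prime P).ne_one

/-! ### §2. Primes above `p` and `v_p(d_K) ≤ Σ_{P | p} f_P · ord_P 𝔇` -/

/-- `pℤ ≠ 0` for a prime `p`. [folklore] -/
theorem span_natCast_int_ne_bot {p : ℕ} (hp : p.Prime) : Ideal.span {(p : ℤ)} ≠ ⊥ := by
  rw [Ne, Ideal.span_singleton_eq_bot, Nat.cast_eq_zero]
  exact hp.ne_zero

/-- `pℤ` is maximal for a prime `p`. [folklore] -/
theorem span_natCast_int_isMaximal {p : ℕ} (hp : p.Prime) : (Ideal.span {(p : ℤ)}).IsMaximal :=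
  (Nat.prime_iff_prime_int.mp hp).isMaximal_span_singleton

/-- A member `P` of the set of primes of `𝓞 K` above the rational prime `p` is maximal, lies over
`pℤ`, and has residue characteristic `p`. [cite: NeukirchANT1999, Ch. I (8.2)] -/
theorem mem_primesOverFinset_span {p : ℕ} (hp : p.Prime) {P : Ideal (𝓞 K)}
    (hP : P ∈ IsDedekindDomain.primesOverFinset (Ideal.span {(p : ℤ)}) (𝓞 K)) :
    P.IsMaximal ∧ P.LiesOver (Ideal.span {(p : ℤ)}) ∧ Ideal.absNorm (P.under ℤ) = p := by
  haveI := span_natCast_int_isMaximal hp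
  obtain ⟨h1, h2⟩ := (IsDedekindDomain.mem_primesOverFinset_iff (span_natCast_int_ne_bot hp) (𝓞 K)).mp hP
  have hP0 : P ≠ ⊥ := Ideal.ne_bot_of_liesOver_of_ne_bot (span_natCast_int_ne_bot hp) P
  have hmax : P.IsMaximal := h1.isMaximal hP0
  refine ⟨hmax, h2, ?_⟩
  haveI : NeZero P := ⟨hP0⟩
  have h3 : Ideal.span {(p : ℤ)} = Ideal.span {((Ideal.absNorm (P.under ℤ) : ℕ) : ℤ)} :=
    h2.over.trans (Int.liesOver_span_absNorm P).over.symm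
  have h4 := (Ideal.span_singleton_eq_span_singleton.mp h3)
  have h5 := Int.natAbs_eq_iff_associated.mpr h4
  simpa using h5.symm

/-- **`v_p(|d_K|) ≤ Σ_{P | p} ord_P(𝔇_{K/ℚ}) · f(P|p)`** (in fact equality): `|d_K| = N(𝔇_{K/ℚ})`
(Mathlib `NumberField.absNorm_differentIdeal`) and `v_p(N(I)) = Σ_{𝔮 ∋ p} v_𝔮(I) f(𝔮|p)` (the tree's
`NumberRing.padicValNat_absNorm_eq_sum`); the primes `𝔮 ∋ p` dividing `𝔇` lie among the primes above
`p`. [cite: NeukirchANT1999, Ch. III (2.9)] -/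
theorem padicValNat_discr_le_sum {p : ℕ} (hp : p.Prime) :
    padicValNat p (discr K).natAbs ≤
      ∑ P ∈ IsDedekindDomain.primesOverFinset (Ideal.span {(p : ℤ)}) (𝓞 K),
        multiplicity P (differentIdeal ℤ (𝓞 K)) * P.inertiaDeg ℤ := by
  classical
  have hD : differentIdeal ℤ (𝓞 K) ≠ ⊥ := differentIdeal_ne_bot
  rw [← NumberField.absNorm_differentIdeal K (𝓞 K),
    Literature.NumberTheory.ComplexMultiplication.NumberRing.padicValNat_absNorm_eq_sum hp hD]
  haveI := span_natCast_int_isMaximal hp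
  calc ∑ 𝔮 ∈ (normalizedFactors (differentIdeal ℤ (𝓞 K))).toFinset.filter
          (fun 𝔮 ↦ (p : 𝓞 K) ∈ 𝔮),
          (normalizedFactors (differentIdeal ℤ (𝓞 K))).count 𝔮 * 𝔮.inertiaDeg ℤ
      = ∑ 𝔮 ∈ (normalizedFactors (differentIdeal ℤ (𝓞 K))).toFinset.filter
          (fun 𝔮 ↦ (p : 𝓞 K) ∈ 𝔮),
          multiplicity 𝔮 (differentIdeal ℤ (𝓞 K)) * 𝔮.inertiaDeg ℤ := by
        refine Finset.sum_congr rfl fun 𝔮 h𝔮 => ?_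
        have hmem := Multiset.mem_toFinset.mp (Finset.mem_filter.mp h𝔮).1
        have hirr := (prime_of_normalized_factor 𝔮 hmem).irreducible
        rw [multiplicity_eq_of_emultiplicity_eq_some
          (emultiplicity_eq_count_normalizedFactors hirr hD), normalize_eq]
    _ ≤ _ := by
        apply Finset.sum_le_sum_of_subset
        intro 𝔮 h𝔮
        obtain ⟨hmem, hpmem⟩ := Finset.mem_filter.mp h𝔮
        have hprime := prime_of_normalized_factor 𝔮 (Multiset.mem_toFinset.mp hmem)
        haveI : 𝔮.IsPrime := Ideal.isPrime_of_prime hprime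
        rw [IsDedekindDomain.mem_primesOverFinset_iff (span_natCast_int_ne_bot hp)]
        refine ⟨inferInstance, ?_⟩
        exact (Ideal.liesOver_span_iff (Ideal.IsPrime.ne_top inferInstance)
          (Nat.prime_iff_prime_int.mp hp)).mpr (by simpa using hpmem)

/-! ### §3. The fundamental identity `Σ_{P | p} e(P|p) f(P|p) = [K : ℚ]` -/

/-- `Σ_{P | p} e(P|p) · f(P|p) = [K : ℚ]` (Mathlib `Ideal.sum_ramification_inertia`, restated with
`Ideal.ramificationIdx` / `Ideal.inertiaDeg`). [cite: NeukirchANT1999, Ch. I (8.2)] -/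
theorem sum_ramificationIdx_mul_inertiaDeg {p : ℕ} (hp : p.Prime) :
    ∑ P ∈ IsDedekindDomain.primesOverFinset (Ideal.span {(p : ℤ)}) (𝓞 K), P.ramificationIdx ℤ * P.inertiaDeg ℤ =
      Module.finrank ℚ K := by
  haveI := span_natCast_int_isMaximal hp
  rw [← Ideal.sum_ramification_inertia (R := ℤ) (𝓞 K) ℚ K (span_natCast_int_ne_bot hp)]
  refine Finset.sum_congr rfl fun P hP => ?_
  obtain ⟨hmax, hover, -⟩ := mem_primesOverFinset_span K hp hP
  rw [Ideal.ramificationIdx'_eq_ramificationIdx _ P (span_natCast_int_ne_bot hp),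
    Ideal.inertiaDeg'_eq_inertiaDeg]

/-- `e(P|p) · f(P|p) ≤ [K : ℚ]` for a prime `P | p`. [cite: NeukirchANT1999, Ch. I (8.2)] -/
theorem ramificationIdx_mul_inertiaDeg_le {p : ℕ} (hp : p.Prime) {P : Ideal (𝓞 K)}
    (hP : P ∈ IsDedekindDomain.primesOverFinset (Ideal.span {(p : ℤ)}) (𝓞 K)) :
    P.ramificationIdx ℤ * P.inertiaDeg ℤ ≤ Module.finrank ℚ K := by
  rw [← sum_ramificationIdx_mul_inertiaDeg K hp]
  exact Finset.single_le_sum (f := fun P : Ideal (𝓞 K) => P.ramificationIdx ℤ * P.inertiaDeg ℤ)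
    (fun _ _ => Nat.zero_le _) hP

/-- `e(P|p) · f(P|p) + e(P₀|p) · f(P₀|p) ≤ [K : ℚ]` for two distinct primes `P, P₀ | p`.
[cite: NeukirchANT1999, Ch. I (8.2)] -/
theorem ramificationIdx_mul_inertiaDeg_add_le {p : ℕ} (hp : p.Prime) {P P₀ : Ideal (𝓞 K)}
    (hP : P ∈ IsDedekindDomain.primesOverFinset (Ideal.span {(p : ℤ)}) (𝓞 K))
    (hP₀ : P₀ ∈ IsDedekindDomain.primesOverFinset (Ideal.span {(p : ℤ)}) (𝓞 K)) (hne : P ≠ P₀) :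
    P.ramificationIdx ℤ * P.inertiaDeg ℤ + P₀.ramificationIdx ℤ * P₀.inertiaDeg ℤ ≤
      Module.finrank ℚ K := by
  classical
  rw [← sum_ramificationIdx_mul_inertiaDeg K hp,
    ← Finset.sum_pair (f := fun P : Ideal (𝓞 K) => P.ramificationIdx ℤ * P.inertiaDeg ℤ) hne]
  refine Finset.sum_le_sum_of_subset fun x hx => ?_
  rcases Finset.mem_insert.mp hx with rfl | hx
  · exact hP
  · rw [Finset.mem_singleton.mp hx]; exact hP₀

/-! ### §4. The caps -/

/-- **Tame sum: if `p ∤ e(P|p)` for every `P | p` then `Σ_{P|p} ord_P(𝔇) f(P|p) ≤ [K:ℚ] - 1`**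
(`ord_P 𝔇 = e - 1`, `Σ (e-1) f = n - Σ f ≤ n - 1`). [cite: NeukirchANT1999, Ch. III (2.6)] -/
theorem sum_multiplicity_mul_inertiaDeg_le_of_forall_not_dvd {p : ℕ} (hp : p.Prime)
    (h : ∀ P ∈ IsDedekindDomain.primesOverFinset (Ideal.span {(p : ℤ)}) (𝓞 K), ¬ p ∣ P.ramificationIdx ℤ) :
    ∑ P ∈ IsDedekindDomain.primesOverFinset (Ideal.span {(p : ℤ)}) (𝓞 K),
        multiplicity P (differentIdeal ℤ (𝓞 K)) * P.inertiaDeg ℤ ≤ Module.finrank ℚ K - 1 := by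
  set T := IsDedekindDomain.primesOverFinset (Ideal.span {(p : ℤ)}) (𝓞 K) with hT
  have hid := sum_ramificationIdx_mul_inertiaDeg K hp
  have hterm : ∀ P ∈ T, multiplicity P (differentIdeal ℤ (𝓞 K)) * P.inertiaDeg ℤ + P.inertiaDeg ℤ =
      P.ramificationIdx ℤ * P.inertiaDeg ℤ := by
    intro P hP
    obtain ⟨hmax, hover, hchar⟩ := mem_primesOverFinset_span K hp hP
    have hpos := Ideal.ramificationIdx_pos P ℤ
    rw [multiplicity_differentIdeal_int_eq_of_not_dvd K P (by rw [hchar]; exact h P hP)]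
    zify [hpos]
    ring
  have hsum : ∑ P ∈ T, multiplicity P (differentIdeal ℤ (𝓞 K)) * P.inertiaDeg ℤ +
      ∑ P ∈ T, P.inertiaDeg ℤ = Module.finrank ℚ K := by
    rw [← hid, ← Finset.sum_add_distrib]
    exact Finset.sum_congr rfl hterm
  have hn : 0 < Module.finrank ℚ K := Module.finrank_pos
  by_cases hTe : T = ∅
  · rw [hTe, Finset.sum_empty]; omega
  · obtain ⟨P₀, hP₀⟩ := Finset.nonempty_iff_ne_empty.mpr hTe
    obtain ⟨hmax, -, -⟩ := mem_primesOverFinset_span K hp hP₀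
    have hf := Finset.single_le_sum (f := fun P : Ideal (𝓞 K) => P.inertiaDeg ℤ)
      (fun _ _ => Nat.zero_le _) hP₀
    have hfpos := Ideal.inertiaDeg_pos P₀ ℤ
    omega

/-- **Tame cap: `[K:ℚ] < p ⇒ v_p(d_K) ≤ [K:ℚ] - 1`** (every `e(P|p) ≤ [K:ℚ] < p` is prime to `p`).
For a cubic field and `p ≥ 5`: `v_p(d_K) ≤ 2`; for a quadratic field and odd `p`: `v_p(d_K) ≤ 1`.
[cite: NeukirchANT1999, Ch. III (2.6)] -/
theorem padicValNat_discr_le_of_finrank_lt {p : ℕ} (hp : p.Prime) (hn : Module.finrank ℚ K < p) :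
    padicValNat p (discr K).natAbs ≤ Module.finrank ℚ K - 1 := by
  refine (padicValNat_discr_le_sum K hp).trans
    (sum_multiplicity_mul_inertiaDeg_le_of_forall_not_dvd K hp fun P hP hdvd => ?_)
  obtain ⟨hmax, -, -⟩ := mem_primesOverFinset_span K hp hP
  have h1 := ramificationIdx_mul_inertiaDeg_le K hp hP
  have hepos := Ideal.ramificationIdx_pos P ℤ
  have hfpos := Ideal.inertiaDeg_pos P ℤ
  have hle : P.ramificationIdx ℤ ≤ Module.finrank ℚ K :=
    le_trans (Nat.le_mul_of_pos_right _ hfpos) h1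
  exact absurd (Nat.le_of_dvd hepos hdvd) (by omega)

/-- **Small-degree cap: `[K:ℚ] ≤ 3 ⇒ v_p(d_K) ≤ 2p - 1`**, i.e. `v₂(d_K) ≤ 3` and `v₃(d_K) ≤ 5` for
cubic (and quadratic) fields: either some `P₀ | p` has `e(P₀|p) = p` — then `f(P₀|p) = 1`, every
other prime above `p` is unramified, and Dedekind–Hensel gives `ord_{P₀} 𝔇 ≤ p(v_p(p) + 1) - 1 = 2p - 1` —
or every `e(P|p) ≤ 3` differs from `p`, hence is prime to `p`, and the tame sum gives `≤ 2`.
[cite: NeukirchANT1999, Ch. III (2.6)] -/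
theorem padicValNat_discr_le_of_finrank_le_three {p : ℕ} (hp : p.Prime)
    (hn : Module.finrank ℚ K ≤ 3) : padicValNat p (discr K).natAbs ≤ 2 * p - 1 := by
  classical
  set T := IsDedekindDomain.primesOverFinset (Ideal.span {(p : ℤ)}) (𝓞 K) with hT
  have hp2 := hp.two_le
  refine (padicValNat_discr_le_sum K hp).trans ?_
  by_cases hex : ∃ P₀ ∈ T, P₀.ramificationIdx ℤ = p
  · obtain ⟨P₀, hP₀, he₀⟩ := hex
    obtain ⟨hmax₀, hover₀, hchar₀⟩ := mem_primesOverFinset_span K hp hP₀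
    have hf₀pos := Ideal.inertiaDeg_pos P₀ ℤ
    have hf₀ : P₀.inertiaDeg ℤ = 1 := by
      have h1 := ramificationIdx_mul_inertiaDeg_le K hp hP₀
      rw [he₀] at h1
      by_contra hne
      have h2 : 2 ≤ P₀.inertiaDeg ℤ := by omega
      nlinarith
    have hothers : ∀ P ∈ T, P ≠ P₀ →
        multiplicity P (differentIdeal ℤ (𝓞 K)) * P.inertiaDeg ℤ = 0 := by
      intro P hP hne
      obtain ⟨hmax, hover, hchar⟩ := mem_primesOverFinset_span K hp hP
      have h2 := ramificationIdx_mul_inertiaDeg_add_le K hp hP hP₀ hne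
      rw [he₀, hf₀, mul_one] at h2
      have hepos := Ideal.ramificationIdx_pos P ℤ
      have hfpos := Ideal.inertiaDeg_pos P ℤ
      have he1 : P.ramificationIdx ℤ = 1 := by
        have : P.ramificationIdx ℤ * P.inertiaDeg ℤ ≤ 1 := by omega
        have : P.ramificationIdx ℤ ≤ 1 := le_trans (Nat.le_mul_of_pos_right _ hfpos) this
        omega
      rw [multiplicity_differentIdeal_int_eq_zero_of_ramificationIdx_eq_one K P he1, zero_mul]
    rw [Finset.sum_eq_single_of_mem P₀ hP₀ (fun P hP hne => hothers P hP hne), hf₀, mul_one]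
    have hw := multiplicity_differentIdeal_int_succ_le K P₀
    rw [hchar₀, he₀, hp.factorization_self] at hw
    omega
  · push Not at hex
    refine (sum_multiplicity_mul_inertiaDeg_le_of_forall_not_dvd K hp fun P hP hdvd => ?_).trans
      (by omega)
    obtain ⟨hmax, -, -⟩ := mem_primesOverFinset_span K hp hP
    have h1 := ramificationIdx_mul_inertiaDeg_le K hp hP
    have hepos := Ideal.ramificationIdx_pos P ℤ
    have hfpos := Ideal.inertiaDeg_pos P ℤ
    have hle : P.ramificationIdx ℤ ≤ 3 :=
      le_trans (le_trans (Nat.le_mul_of_pos_right _ hfpos) h1) hn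
    have hne := hex P hP
    obtain ⟨k, hk⟩ := hdvd
    rcases k with _ | _ | k
    · simp at hk; omega
    · simp at hk; exact hne hk
    · nlinarith

/-- `v₂(d_K) ≤ 3` for `[K:ℚ] ≤ 3`. [cite: NeukirchANT1999, Ch. III (2.6)] -/
theorem padicValNat_two_discr_le_three (hn : Module.finrank ℚ K ≤ 3) :
    padicValNat 2 (discr K).natAbs ≤ 3 := by
  simpa using padicValNat_discr_le_of_finrank_le_three K Nat.prime_two hn

/-- `v₃(d_K) ≤ 5` for `[K:ℚ] ≤ 3`. [cite: NeukirchANT1999, Ch. III (2.6)] -/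
theorem padicValNat_three_discr_le_five (hn : Module.finrank ℚ K ≤ 3) :
    padicValNat 3 (discr K).natAbs ≤ 5 := by
  simpa using padicValNat_discr_le_of_finrank_le_three K Nat.prime_three hn

end Summit.ABC.ABC.Theorems

end
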